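import Literature.Probability.LatticeModels.CISWeakClosure
import Literature.Probability.Percolation.PositiveAssociation
import HarnessLib

/-!
# Colangelo–Müller–Scarsini's Definition 4 in dimension `≥ 3`: two further scope facts — I: the finite reduction
# for atomic laws (part II, the examples: `SahiCISDefinitionFourScope.lean`)

Cell `prim-sahi`, literature seat (generation 29; landed by the typer seat, generation 17, Theorems/ being prover-only;
split in two files for the 400-line limit); `--supports stmt-CriticalPhenomena-4575`.  Companion of
`SahiCISDefinitionFour.lean` (typer gen 17), which shows that Theorem 4 (a) ⇒ (b) of the source fails as printed
for `d = 3`.  No named facts, no sorries; the examples are explicit finitely-atomic laws and the combinatorial core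
is a kernel computation (`decide`).

Source (verbatim statements are in the citation header of `Literature/Probability/LatticeModels/CISWeakClosure.lean`):
A. Colangelo, A. Müller, M. Scarsini, *Positive dependence and weak convergence*, J. Appl. Probab. **43** (2006)
48–59, §3 p. 51 ("`C < D` if … `cᵢ < dᵢ` for `i = 1,…,d`"), §4 Definition 4 (the tree's `CondIncrGiven` /
`IsCIS`), Theorem 4 (c) (the tree's interval form `CondIncrOn` / `IsCISc`), Theorem 5. [ColangeloMullerScarsini2006]
A. Müller, D. Stoyan, *Comparison Methods for Stochastic Models and Risks*, Wiley 2002, Def. 3.10.9, Thm. 3.10.11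
("If X is CIS then it is associated"). [MullerStoyan2002]

## Contents

* `natAtomic b w` — the finite measure `∑ₖ w k • δ_{pt b k}` on `ℝ^ι` with natural weights `w k` at the lattice
  points `pt b k = (b k i)_i` with natural coordinates; `natAtomic_apply`, `natAtomic_apply_filter`.
* `condIncrGiven_natAtomic` — **finite reduction of Definition 4** for such laws: Definition 4 given `X_J` holds as
  soon as, for every pair of `J`-fibres of atoms whose `J`-coordinates are STRICTLY separated in every coordinate
  of `J` and every up-closed set `T` of atoms, `m(F ∩ T) m(F') ≤ m(F' ∩ T) m(F)`; `condIncrGiven_natAtomic_of_bits`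
  — the same with `T` encoded as a bitmask, a `decide`-able hypothesis once `b`, `w`, `J` are numerals.
* **(c) ⇏ (a) in Theorem 4, `d = 3`** (`cmsExampleC` = `δ_{(0,0,1)} + δ_{(1,0,0)}`, twice the law of
  `(ξ, 0, 1 − ξ)`, `ξ` a fair coin): `isCISc_cmsExampleC` (the interval form (c) holds: for `k = 1` the response
  coordinate is constant, for `k = 2` the two conditioning atoms `(0,0)`, `(1,0)` share a coordinate, so no
  strictly separated pair of boxes charges both) and `not_isCIS_cmsExampleC` (Definition 4 fails at `k = 1`:
  B1 would give `µ{x₂ > ½} µ{x₀ > ½} ≤ µ({x₂ > ½} ∩ {x₀ > ½}) µ(ℝ³)`, i.e. `1 ≤ 0`).  Consequently the printed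
  proof of Theorem 5, which passes through (c), establishes the weak closure of the interval form (c) only
  (`IsCISc.of_tendsto` in the Literature file).
* **CI in the sense of Definition 4 does not imply positive association, `d = 4`** (`cmsExampleCI` = the law
  `(3 δ_{0000} + 2 δ_{0011} + 6 δ_{1010} + 2 δ_{1100} + 6 δ_{1111}) / 19` on `ℝ⁴`):
  `condIncrGiven_cmsExampleCI` (Definition 4 given EVERY set of conditioning coordinates — by the finite
  reduction and `decide`), hence `isCIS_cmsExampleCI_perm` (CIS in the sense of Definition 4 after EVERY
  permutation of the coordinates, i.e. Definition-4-CI), but `not_isPositivelyAssociated_cmsExampleCI`: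
  `µ(U) µ(V) = 120/361 > 114/361 = µ(U ∩ V)` for the increasing events `U = {x₀ > ½, x₂ > ½}`,
  `V = {x₂ > ½, x₃ > ½} ∪ {x₀ > ½, x₁ > ½}`.  Classically, conditionally increasing laws are conditionally
  increasing in sequence and hence associated (Müller–Stoyan Thm. 3.10.11); so the symmetrised Definition 4 is
  not the classical CI either, and a Definition-4-CI law need not be Sahi-positive even at order 2.

Both examples were first found/checked by exact enumeration (cell HOME `code/lit/def4ci_exact.py`,
`code/lit/def4ci_indep.py`); this file is the kernel check.
-/

noncomputable section

namespace Summit.CriticalPhenomena.PercolationContinuityZ3.Theorems.SahiCIS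

open MeasureTheory Set
open Literature.Probability.LatticeModels.ConditionallyIncreasing
open Literature.Probability.Percolation (IsPositivelyAssociated)
open scoped ENNReal

/-! ### Finitely-atomic laws with natural coordinates and weights -/

section NatAtomic

variable {κ : Type*} {ι : Type*}

/-- The lattice point of `ℝ^ι` with natural coordinates `b k`. [folklore] -/
def pt (b : κ → ι → ℕ) (k : κ) : ι → ℝ := fun i => (b k i : ℝ)

/-- Coordinates of `pt`. [folklore] -/
@[simp] theorem pt_apply (b : κ → ι → ℕ) (k : κ) (i : ι) : pt b k i = (b k i : ℝ) := rfl

/-- `pt` is monotone in the natural coordinates. [folklore] -/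
theorem pt_le_pt_of_le {b : κ → ι → ℕ} {k k' : κ} (h : ∀ i, b k i ≤ b k' i) : pt b k ≤ pt b k' :=
  fun i => by simpa [pt] using (Nat.cast_le (α := ℝ)).2 (h i)

/-- `½ < n` for a natural number `n` iff `1 ≤ n`. [folklore] -/
theorem half_lt_natCast_iff (n : ℕ) : (2⁻¹ : ℝ) < (n : ℝ) ↔ 1 ≤ n := by
  rcases Nat.eq_zero_or_pos n with rfl | hn
  · norm_num
  · exact ⟨fun _ => hn, fun _ => lt_of_lt_of_le (by norm_num) (Nat.one_le_cast.2 hn)⟩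

/-- **The finitely-atomic law** `∑ₖ w k • δ_{pt b k}` on `ℝ^ι` (natural weights, natural coordinates).
[this work] -/
def natAtomic [Fintype κ] (b : κ → ι → ℕ) (w : κ → ℕ) : Measure (ι → ℝ) :=
  ∑ k, (w k : ℝ≥0∞) • Measure.dirac (pt b k)

/-- Evaluation on a measurable set: `µ(S) = ∑ₖ w k · 1_S(pt b k)`. [this work] -/
theorem natAtomic_apply [Fintype κ] (b : κ → ι → ℕ) (w : κ → ℕ) {S : Set (ι → ℝ)} (hS : MeasurableSet S) :
    natAtomic b w S = ∑ k, (w k : ℝ≥0∞) * S.indicator 1 (pt b k) := by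
  rw [natAtomic, Measure.finsetSum_apply]
  refine Finset.sum_congr rfl fun k _ => ?_
  rw [Measure.smul_apply, smul_eq_mul, Measure.dirac_apply' _ hS]

/-- Evaluation on a measurable set as a natural number: `µ(S) = ∑_{k : pt b k ∈ S} w k`. [this work] -/
theorem natAtomic_apply_filter [Fintype κ] (b : κ → ι → ℕ) (w : κ → ℕ) {S : Set (ι → ℝ)}
    (hS : MeasurableSet S) [DecidablePred fun k => pt b k ∈ S] :
    natAtomic b w S = ((∑ k ∈ Finset.univ.filter (fun k => pt b k ∈ S), w k : ℕ) : ℝ≥0∞) := by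
  rw [natAtomic_apply b w hS, Nat.cast_sum, Finset.sum_filter]
  refine Finset.sum_congr rfl fun k _ => ?_
  by_cases hk : pt b k ∈ S
  · rw [Set.indicator_of_mem hk, if_pos hk, Pi.one_apply, mul_one]
  · rw [Set.indicator_of_notMem hk, if_neg hk, mul_zero]

/-- The total mass is `∑ₖ w k`. [this work] -/
theorem natAtomic_univ [Fintype κ] (b : κ → ι → ℕ) (w : κ → ℕ) :
    natAtomic b w univ = ((∑ k, w k : ℕ) : ℝ≥0∞) := by
  classical
  rw [natAtomic_apply_filter b w MeasurableSet.univ]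
  simp

/-- A finitely-atomic law with natural weights is a finite measure. [folklore] -/
instance isFiniteMeasure_natAtomic [Fintype κ] (b : κ → ι → ℕ) (w : κ → ℕ) :
    IsFiniteMeasure (natAtomic b w) :=
  ⟨by rw [natAtomic_univ]; exact ENNReal.natCast_lt_top _⟩

/-- If an atomic law charges a measurable set, some atom lies in it. [this work] -/
theorem exists_pt_mem_of_natAtomic_ne_zero [Fintype κ] (b : κ → ι → ℕ) (w : κ → ℕ) {S : Set (ι → ℝ)}
    (hS : MeasurableSet S) (h : natAtomic b w S ≠ 0) : ∃ k, pt b k ∈ S := by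
  by_contra hne
  simp only [not_exists] at hne
  apply h
  rw [natAtomic_apply b w hS]
  exact Finset.sum_eq_zero fun k _ => by rw [Set.indicator_of_notMem (hne k), mul_zero]

/-- An atomic law does not charge a measurable set avoiding all atoms. [this work] -/
theorem natAtomic_eq_zero_of_forall_notMem [Fintype κ] (b : κ → ι → ℕ) (w : κ → ℕ) {S : Set (ι → ℝ)}
    (hS : MeasurableSet S) (h : ∀ k, pt b k ∉ S) : natAtomic b w S = 0 := by
  rw [natAtomic_apply b w hS]
  exact Finset.sum_eq_zero fun k _ => by rw [Set.indicator_of_notMem (h k), mul_zero]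

/-- Definition 4 is homogeneous: it is invariant under scaling the measure. [this work] -/
theorem condIncrGiven_smul {μ : Measure (ι → ℝ)} {J : Finset ι} (h : CondIncrGiven μ J) (c : ℝ≥0∞) :
    CondIncrGiven (c • μ) J := by
  intro A B hA hB hAB U hUu hUm
  simp only [Measure.smul_apply, smul_eq_mul]
  calc c * μ (U ∩ cyl J A) * (c * μ (cyl J B)) = c * c * (μ (U ∩ cyl J A) * μ (cyl J B)) := by ring
    _ ≤ c * c * (μ (U ∩ cyl J B) * μ (cyl J A)) := by gcongr c * c * ?_; exact h hA hB hAB hUu hUm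
    _ = c * μ (U ∩ cyl J B) * (c * μ (cyl J A)) := by ring

end NatAtomic

/-! ### The finite reduction of Definition 4 for atomic laws -/

section Reduction

variable {κ : Type*} {ι : Type*}

/-- The `J`-projection of the natural coordinates of the atom `k`. [this work] -/
def prJ (b : κ → ι → ℕ) (J : Finset ι) (k : κ) : ↥J → ℕ := fun j => b k j

/-- Two atoms have the same `J`-projection iff their coordinates agree on `J`. [this work] -/
theorem prJ_eq_iff (b : κ → ι → ℕ) (J : Finset ι) (k k₀ : κ) :
    prJ b J k = prJ b J k₀ ↔ ∀ j ∈ J, b k j = b k₀ j :=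
  ⟨fun h j hj => congrFun h ⟨j, hj⟩, fun h => funext fun j => h j j.2⟩

/-- The `J`-fibre of the atom `k₀`: all atoms with the same `J`-coordinates. [this work] -/
def fib [Fintype κ] (b : κ → ι → ℕ) (J : Finset ι) (k₀ : κ) : Finset κ :=
  Finset.univ.filter fun k => ∀ j ∈ J, b k j = b k₀ j

/-- The mass `∑_{k ∈ S} w k` of a set of atoms. [this work] -/
def mass (w : κ → ℕ) (S : Finset κ) : ℕ := ∑ k ∈ S, w k

/-- Atoms with the same `J`-coordinates have the same `J`-restriction. [this work] -/
theorem restrict_pt_eq_of_fib {b : κ → ι → ℕ} {J : Finset ι} {k k₀ : κ} (h : ∀ j ∈ J, b k j = b k₀ j) :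
    J.restrict (pt b k) = J.restrict (pt b k₀) :=
  funext fun j => by
    show ((b k j : ℕ) : ℝ) = ((b k₀ j : ℕ) : ℝ)
    rw [h j j.2]

/-- **Finite reduction**: the fibre-pair condition implies Definition 4 given `X_J` for the atomic law
(arbitrary Borel `A < B ⊆ ℝ^J`, arbitrary measurable up-sets `U ⊆ ℝ^ι`).  Proof: `µ(U ∩ Â)`, `µ(B̂)`, … are
masses of the sets of atoms `S_A ∩ T`, `S_B`, … where `S_A = {k : (pt k)_J ∈ A}` is a union of `J`-fibres,
`T = {k : pt k ∈ U}` is up-closed, and any fibre in `S_A` is strictly separated from any fibre in `S_B`; expand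
both sides fibrewise and compare termwise. [this work] -/
theorem condIncrGiven_natAtomic [Fintype κ] [DecidableEq κ] (b : κ → ι → ℕ) (w : κ → ℕ) (J : Finset ι)
    (H : ∀ k₀ k₁ : κ, (∀ j ∈ J, b k₀ j < b k₁ j) → ∀ T : Finset κ,
      (∀ k ∈ T, ∀ k' : κ, (∀ i, b k i ≤ b k' i) → k' ∈ T) →
        mass w (fib b J k₀ ∩ T) * mass w (fib b J k₁) ≤ mass w (fib b J k₁ ∩ T) * mass w (fib b J k₀)) :
    CondIncrGiven (natAtomic b w) J := by
  classical
  intro A B hA hB hAB U hUu hUm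
  -- the sets of atoms
  set SA : Finset κ := Finset.univ.filter fun k => J.restrict (pt b k) ∈ A with hSA
  set SB : Finset κ := Finset.univ.filter fun k => J.restrict (pt b k) ∈ B with hSB
  set T : Finset κ := Finset.univ.filter fun k => pt b k ∈ U with hT
  have hcA : MeasurableSet (cyl J A) := measurableSet_cyl J hA
  have hcB : MeasurableSet (cyl J B) := measurableSet_cyl J hB
  -- the four measures as masses
  have e1 : natAtomic b w (U ∩ cyl J A) = ((mass w (SA ∩ T) : ℕ) : ℝ≥0∞) := by
    rw [natAtomic_apply_filter b w (hUm.inter hcA), mass]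
    congr 2; ext k
    simp only [Finset.mem_filter, Finset.mem_univ, true_and, Finset.mem_inter, Set.mem_inter_iff, cyl,
      Set.mem_preimage, hSA, hT]
    exact and_comm
  have e2 : natAtomic b w (cyl J B) = ((mass w SB : ℕ) : ℝ≥0∞) := by
    rw [natAtomic_apply_filter b w hcB, mass]
    congr 2
  have e3 : natAtomic b w (U ∩ cyl J B) = ((mass w (SB ∩ T) : ℕ) : ℝ≥0∞) := by
    rw [natAtomic_apply_filter b w (hUm.inter hcB), mass]
    congr 2; ext k
    simp only [Finset.mem_filter, Finset.mem_univ, true_and, Finset.mem_inter, Set.mem_inter_iff, cyl,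
      Set.mem_preimage, hSB, hT]
    exact and_comm
  have e4 : natAtomic b w (cyl J A) = ((mass w SA : ℕ) : ℝ≥0∞) := by
    rw [natAtomic_apply_filter b w hcA, mass]
    congr 2
  rw [e1, e2, e3, e4, ← Nat.cast_mul, ← Nat.cast_mul]
  refine Nat.cast_le.2 ?_
  -- up-closedness of T and strict separation of SA from SB
  have hTup : ∀ k ∈ T, ∀ k' : κ, (∀ i, b k i ≤ b k' i) → k' ∈ T := by
    intro k hk k' hkk'
    simp only [hT, Finset.mem_filter, Finset.mem_univ, true_and] at hk ⊢
    exact hUu (pt_le_pt_of_le hkk') hk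
  have hsep : ∀ k₀ ∈ SA, ∀ k₁ ∈ SB, ∀ j ∈ J, b k₀ j < b k₁ j := by
    intro k₀ hk₀ k₁ hk₁ j hj
    simp only [hSA, hSB, Finset.mem_filter, Finset.mem_univ, true_and] at hk₀ hk₁
    have := hAB _ hk₀ _ hk₁ ⟨j, hj⟩
    exact (Nat.cast_lt (α := ℝ)).1 this
  -- SA and SB are unions of fibres
  have hfibA : ∀ k₀ ∈ SA, ∀ S : Finset κ,
      (SA ∩ S).filter (fun k => prJ b J k = prJ b J k₀) = fib b J k₀ ∩ S := by
    intro k₀ hk₀ S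
    ext k
    simp only [Finset.mem_filter, Finset.mem_inter, fib, Finset.mem_univ, true_and, prJ_eq_iff]
    constructor
    · rintro ⟨⟨_, hkS⟩, hk⟩; exact ⟨hk, hkS⟩
    · rintro ⟨hk, hkS⟩
      refine ⟨⟨?_, hkS⟩, hk⟩
      simp only [hSA, Finset.mem_filter, Finset.mem_univ, true_and] at hk₀ ⊢
      rwa [restrict_pt_eq_of_fib hk]
  have hfibB : ∀ k₁ ∈ SB, ∀ S : Finset κ,
      (SB ∩ S).filter (fun k => prJ b J k = prJ b J k₁) = fib b J k₁ ∩ S := by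
    intro k₁ hk₁ S
    ext k
    simp only [Finset.mem_filter, Finset.mem_inter, fib, Finset.mem_univ, true_and, prJ_eq_iff]
    constructor
    · rintro ⟨⟨_, hkS⟩, hk⟩; exact ⟨hk, hkS⟩
    · rintro ⟨hk, hkS⟩
      refine ⟨⟨?_, hkS⟩, hk⟩
      simp only [hSB, Finset.mem_filter, Finset.mem_univ, true_and] at hk₁ ⊢
      rwa [restrict_pt_eq_of_fib hk]
  -- fibrewise expansion of the four masses
  have expand : ∀ (S R : Finset κ), mass w (S ∩ R) =
      ∑ v ∈ S.image (prJ b J), mass w ((S ∩ R).filter fun k => prJ b J k = v) := by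
    intro S R
    simp only [mass]
    exact (Finset.sum_fiberwise_of_maps_to
      (fun k hk => Finset.mem_image_of_mem _ (Finset.mem_inter.1 hk).1) _).symm
  have expandA' : mass w SA =
      ∑ v ∈ SA.image (prJ b J), mass w ((SA ∩ Finset.univ).filter fun k => prJ b J k = v) := by
    rw [← expand SA Finset.univ, Finset.inter_univ]
  have expandB' : mass w SB =
      ∑ v ∈ SB.image (prJ b J), mass w ((SB ∩ Finset.univ).filter fun k => prJ b J k = v) := by
    rw [← expand SB Finset.univ, Finset.inter_univ]
  rw [expand SA T, expand SB T, expandA', expandB', Finset.sum_mul_sum, Finset.sum_mul_sum]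
  conv_rhs => rw [Finset.sum_comm]
  -- termwise comparison
  refine Finset.sum_le_sum fun v hv => Finset.sum_le_sum fun u hu => ?_
  obtain ⟨k₀, hk₀, rfl⟩ := Finset.mem_image.1 hv
  obtain ⟨k₁, hk₁, rfl⟩ := Finset.mem_image.1 hu
  rw [hfibA k₀ hk₀ T, hfibB k₁ hk₁ Finset.univ, hfibB k₁ hk₁ T, hfibA k₀ hk₀ Finset.univ, Finset.inter_univ,
    Finset.inter_univ]
  exact H k₀ k₁ (hsep k₀ hk₀ k₁ hk₁) T hTup

/-- Definition-4-CIS after a permutation of the coordinates, from Definition 4 given every set of conditioning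
coordinates (Theorem 6, B5 of the source, `CondIncrGiven.map_equiv`). [this work] -/
theorem isCIS_map_perm_of_forall_condIncrGiven {d : ℕ} {μ : Measure (Fin d → ℝ)}
    (h : ∀ J : Finset (Fin d), CondIncrGiven μ J) (σ : Equiv.Perm (Fin d)) :
    IsCIS (μ.map fun (x : Fin d → ℝ) (i : Fin d) => x (σ i)) :=
  fun _ => (h _).map_equiv σ

end Reduction

/-! ### The bitmask form of the fibre-pair condition (kernel-decidable) -/

section Bits

variable {n d : ℕ}

/-- `T` (a bitmask `m` over the atoms) is up-closed for the coordinatewise order. [this work] -/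
def upClosedBits (b : Fin n → Fin d → ℕ) (m : ℕ) : Bool :=
  decide (∀ k k' : Fin n, Nat.testBit m k = true → (∀ i, b k i ≤ b k' i) → Nat.testBit m k' = true)

/-- The `J`-coordinates of the atoms `k₀`, `k₁` are strictly separated in every coordinate of `J`. [this work] -/
def sepBits (b : Fin n → Fin d → ℕ) (J : Finset (Fin d)) (k₀ k₁ : Fin n) : Bool :=
  decide (∀ j ∈ J, b k₀ j < b k₁ j)

/-- Mass of the `J`-fibre of `k₀` inside the bitmask `m`. [this work] -/
def fibMassIn (b : Fin n → Fin d → ℕ) (w : Fin n → ℕ) (m : ℕ) (J : Finset (Fin d)) (k₀ : Fin n) : ℕ :=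
  ∑ k : Fin n, if (Nat.testBit m k = true ∧ ∀ j ∈ J, b k j = b k₀ j) then w k else 0

/-- Mass of the `J`-fibre of `k₀`. [this work] -/
def fibMass (b : Fin n → Fin d → ℕ) (w : Fin n → ℕ) (J : Finset (Fin d)) (k₀ : Fin n) : ℕ :=
  ∑ k : Fin n, if (∀ j ∈ J, b k j = b k₀ j) then w k else 0

/-- The fibre-pair inequality `m(F₀ ∩ T) m(F₁) ≤ m(F₁ ∩ T) m(F₀)` for the bitmask `T = m`. [this work] -/
def fpIneqBits (b : Fin n → Fin d → ℕ) (w : Fin n → ℕ) (m : ℕ) (J : Finset (Fin d)) (k₀ k₁ : Fin n) : Bool :=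
  decide (fibMassIn b w m J k₀ * fibMass b w J k₁ ≤ fibMassIn b w m J k₁ * fibMass b w J k₀)

/-- Every finite set of atoms is a bitmask. [folklore] -/
theorem exists_bitmask (T : Finset (Fin n)) : ∃ m < 2 ^ n, ∀ k : Fin n, k ∈ T ↔ Nat.testBit m k = true := by
  induction T using Finset.induction_on with
  | empty => exact ⟨0, by positivity, fun k => by simp⟩
  | @insert a T ha ih =>
    obtain ⟨m, hm, hmem⟩ := ih
    refine ⟨m ||| 2 ^ (a : ℕ), Nat.or_lt_two_pow hm (Nat.pow_lt_pow_right (by norm_num) a.2), fun k => ?_⟩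
    rw [Finset.mem_insert, hmem k, Nat.testBit_or, Nat.testBit_two_pow, Bool.or_eq_true, decide_eq_true_eq]
    constructor
    · rintro (h | h)
      · exact Or.inr (by rw [h])
      · exact Or.inl h
    · rintro (h | h)
      · exact Or.inr h
      · exact Or.inl (Fin.ext h.symm)

/-- **Finite reduction, bitmask form**: if the `decide`-able fibre-pair inequalities hold for every up-closed
bitmask of atoms and every strictly `J`-separated pair of atoms, then Definition 4 given `X_J` holds for the
atomic law. [this work] -/
theorem condIncrGiven_natAtomic_of_bits (b : Fin n → Fin d → ℕ) (w : Fin n → ℕ) (J : Finset (Fin d))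
    (H : ∀ m < 2 ^ n, upClosedBits b m = true → ∀ k₀ k₁ : Fin n, sepBits b J k₀ k₁ = true →
      fpIneqBits b w m J k₀ k₁ = true) :
    CondIncrGiven (natAtomic b w) J := by
  classical
  refine condIncrGiven_natAtomic b w J fun k₀ k₁ hsep T hT => ?_
  obtain ⟨m, hm, hmem⟩ := exists_bitmask T
  have hup : upClosedBits b m = true :=
    decide_eq_true fun k k' hk hle => (hmem k').1 (hT k ((hmem k).2 hk) k' hle)
  have hs : sepBits b J k₀ k₁ = true := decide_eq_true hsep
  have h := of_decide_eq_true (H m hm hup k₀ k₁ hs)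
  have e1 : ∀ k₀, fibMassIn b w m J k₀ = mass w (fib b J k₀ ∩ T) := by
    intro k₀
    rw [fibMassIn, mass, ← Finset.sum_filter]
    congr 1; ext k
    simp only [Finset.mem_filter, Finset.mem_univ, true_and, Finset.mem_inter, fib, hmem k]
    exact and_comm
  have e2 : ∀ k₀, fibMass b w J k₀ = mass w (fib b J k₀) := by
    intro k₀
    simp only [fibMass, mass, fib, Finset.sum_filter]
    all_goals exact Finset.sum_congr rfl fun k _ => by congr 1
  rw [e1, e1, e2, e2] at h
  exact h

end Bits

end Summit.CriticalPhenomena.PercolationContinuityZ3.Theorems.SahiCIS
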